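import Literature.Analysis.FluidPDE.TypeIAncientMild
import Literature.Analysis.FluidPDE.KNSSTypeIRateMildProofs
import Literature.Analysis.FluidPDE.ClassicalSolutionRescale
import Literature.Analysis.FluidPDE.PressurePoisson
import Literature.Analysis.FluidPDE.LocalTypeIScaling
import Literature.Analysis.FluidPDE.LerayGaugeStrainSpectrum
import HarnessLib

/-!
# Scaling and translation invariance of the Type-I model class (route `SqueezeCycle`,
# item `ExtremalElementExists`, stmt-NavierStokesRegularity-11611)

Helper file. For `c > 0` and `x₀ ∈ ℝ³` the Navier–Stokes zoom about the space-time point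
`(0, x₀)`, `w = c • stPull (c²) c 0 x₀ u`, i.e. `w(s, y) = c u(c² s, x₀ + c y)`, preserves

* the Oseen-gauge Type-I ancient mild class `IsTypeIAncientMild C` (`isTypeIAncientMild_zoom`;
  the integral equation by `oseen_smul_stPull`, KNSS 2009 §1 (1.2));
* the two scale-invariant local energy bounds of the route's class `𝒦_C`
  (`scaledEnergy_zoom`, `scaledGradEnergy_zoom`: `sup_Q r⁻¹ ∫_{B_r} |u|²` and
  `r⁻¹ ∫∫_{Q_r} |∇u|²` over backward parabolic cylinders with vertex time `≤ 0`);
* the Leray-gauge middle strain eigenvalue: `Λ_w(s, y) = Λ_u(c² s, x₀ + c y)`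
  (`lerayMiddleStrain_zoom`).
-/

noncomputable section

open MeasureTheory Set Function Filter TopologicalSpace Metric
open scoped Topology NNReal ENNReal InnerProductSpace

namespace Summit.NavierStokesRegularity.NavierStokesRegularity.Theorems

open Literature.Analysis Literature.Analysis.FluidPDE

section Zoom

variable {C : ℝ} {u : ℝ → EuclideanSpace ℝ (Fin 3) → EuclideanSpace ℝ (Fin 3)}

/-- The zoomed field, unfolded: `(c • stPull (c²) c 0 x₀ u) s y = c • u (c² s) (x₀ + c y)`.
[folklore] -/
theorem zoom_apply (c : ℝ) (x₀ : EuclideanSpace ℝ (Fin 3))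
    (u : ℝ → EuclideanSpace ℝ (Fin 3) → EuclideanSpace ℝ (Fin 3)) (s : ℝ)
    (y : EuclideanSpace ℝ (Fin 3)) :
    (c • stPull (c ^ 2) c 0 x₀ u) s y = c • u (c ^ 2 * s) (x₀ + c • y) := by
  simp [stPull_apply]

/-- The slice of the zoomed field: `(c • stPull (c²) c 0 x₀ u) s = fun y => c • u (c² s) (x₀ + c y)`.
[folklore] -/
theorem zoom_slice (c : ℝ) (x₀ : EuclideanSpace ℝ (Fin 3))
    (u : ℝ → EuclideanSpace ℝ (Fin 3) → EuclideanSpace ℝ (Fin 3)) (s : ℝ) :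
    (c • stPull (c ^ 2) c 0 x₀ u) s = fun y => c • u (c ^ 2 * s) (x₀ + c • y) := by
  funext y; exact zoom_apply c x₀ u s y

/-- The gradient of the zoomed slice: `∇(c u(c²s, x₀ + c ·))(y) = c² ∇u(c² s)(x₀ + c y)` when
the slice `u (c² s)` is differentiable. [folklore] -/
theorem fderiv_zoom {c : ℝ} (x₀ : EuclideanSpace ℝ (Fin 3))
    (u : ℝ → EuclideanSpace ℝ (Fin 3) → EuclideanSpace ℝ (Fin 3)) {s : ℝ}
    (hd : Differentiable ℝ (u (c ^ 2 * s))) (y : EuclideanSpace ℝ (Fin 3)) :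
    fderiv ℝ ((c • stPull (c ^ 2) c 0 x₀ u) s) y =
      (c ^ 2) • fderiv ℝ (u (c ^ 2 * s)) (x₀ + c • y) := by
  have hd' : Differentiable ℝ (stPull (c ^ 2) c 0 x₀ u s) :=
    differentiable_stPull_slice (by simpa using hd)
  rw [show (c • stPull (c ^ 2) c 0 x₀ u) s = fun z => c • stPull (c ^ 2) c 0 x₀ u s z from rfl,
    fderiv_fun_const_smul (hd' y), fderiv_stPull, smul_smul, zero_add, sq]

/-- **The Type-I ancient mild class is invariant under the Navier–Stokes zoom** about `(0, x₀)`: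
joint smoothness (`IsSmoothSpaceTimeOn.smul_stPull`), divergence-freeness
(`divergence_stPull`), the Oseen integral equation (`oseen_smul_stPull`, KNSS 2009 §1 (1.2)) and
the Type-I bound `c · C/√(-c²s) = C/√(-s)`. [cite: KochNadirashviliSereginSverak2009, §1 (1.2) (arXiv:0709.3599 p. 2)] -/
theorem isTypeIAncientMild_zoom (hu : IsTypeIAncientMild C u) {c : ℝ} (hc : 0 < c)
    (x₀ : EuclideanSpace ℝ (Fin 3)) : IsTypeIAncientMild C (c • stPull (c ^ 2) c 0 x₀ u) := by
  have hc2 : 0 < c ^ 2 := by positivity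
  have hneg : ∀ {s : ℝ}, s < 0 → c ^ 2 * s < 0 := fun hs => mul_neg_of_pos_of_neg hc2 hs
  refine ⟨?_, fun s hs y => ?_, fun σ τ hστ hτ y => ?_, fun s hs y => ?_⟩
  · -- joint smoothness
    have h := IsSmoothSpaceTimeOn.smul_stPull (S := Iio 0) (u := u) hu.contDiffOn c (c ^ 2) c 0 x₀
    refine (h.mono fun r (hr : r < 0) => ?_ : IsSmoothSpaceTimeOn (Iio 0) _)
    show 0 + c ^ 2 * r ∈ Iio 0
    rw [zero_add]; exact hneg hr
  · -- divergence free
    have hs' : c ^ 2 * s < 0 := hneg hs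
    have hu1 : Differentiable ℝ (u (0 + c ^ 2 * s)) := by
      rw [zero_add]; exact (hu.contDiff_slice hs').differentiable (by simp)
    have hd : DifferentiableAt ℝ (stPull (c ^ 2) c 0 x₀ u s) y :=
      differentiable_stPull_slice hu1 y
    rw [show (c • stPull (c ^ 2) c 0 x₀ u) s = fun z => c • stPull (c ^ 2) c 0 x₀ u s z from rfl,
      divergence_const_smul_apply hd, divergence_stPull, zero_add, hu.isDivFree hs', mul_zero,
      mul_zero]
  · -- the Oseen integral equation
    have hτ' : 0 + c ^ 2 * τ < 0 := by rw [zero_add]; exact hneg hτ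
    have hστ' : 0 + c ^ 2 * σ < 0 + c ^ 2 * τ := by nlinarith
    rw [heatFlow_of_pos _ (sub_pos.2 hστ)]
    exact oseen_smul_stPull hc 0 x₀ hστ (fun X => hu.mild_eq_heatExtension hστ' hτ' X) y
  · -- the Type-I bound
    have hs' : c ^ 2 * s < 0 := hneg hs
    rw [zoom_apply, norm_smul, Real.norm_of_nonneg hc.le]
    have h := hu.norm_le hs' (x₀ + c • y)
    have hsq : Real.sqrt (-(c ^ 2 * s)) = c * Real.sqrt (-s) := by
      rw [show -(c ^ 2 * s) = c ^ 2 * (-s) by ring, Real.sqrt_mul' _ (neg_nonneg.2 hs.le),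
        Real.sqrt_sq hc.le]
    rw [hsq] at h
    have hspos : 0 < Real.sqrt (-s) := Real.sqrt_pos.2 (neg_pos.2 hs)
    calc c * ‖u (c ^ 2 * s) (x₀ + c • y)‖ ≤ c * (C / (c * Real.sqrt (-s))) :=
          mul_le_mul_of_nonneg_left h hc.le
      _ = C / Real.sqrt (-s) := by field_simp

/-! ### The scale-invariant energies -/

/-- **Scaling of the local kinetic energy**: `r⁻¹ ∫_{B(y₀, r)} |w(s, y)|² dy =
(c r)⁻¹ ∫_{B(x₀ + c y₀, c r)} |u(c² s, x)|² dx` for the zoom `w(s, y) = c u(c² s, x₀ + c y)`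
(substitution `x = x₀ + c y`). [folklore] -/
theorem scaledEnergy_zoom {c : ℝ} (hc : 0 < c) (x₀ y₀ : EuclideanSpace ℝ (Fin 3))
    (u : ℝ → EuclideanSpace ℝ (Fin 3) → EuclideanSpace ℝ (Fin 3)) (s : ℝ) {r : ℝ} (hr : 0 < r) :
    r⁻¹ * ∫ y in ball y₀ r, ‖(c • stPull (c ^ 2) c 0 x₀ u) s y‖ ^ 2 =
      (c * r)⁻¹ * ∫ x in ball (x₀ + c • y₀) (c * r), ‖u (c ^ 2 * s) x‖ ^ 2 := by
  set F : EuclideanSpace ℝ (Fin 3) → ℝ := fun x => ‖u (c ^ 2 * s) x‖ ^ 2 with hF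
  have hpre := space_affine_preimage_ball_zoom hc x₀ y₀ r
  have h1 : (fun y => ‖(c • stPull (c ^ 2) c 0 x₀ u) s y‖ ^ 2) =
      fun y => c ^ 2 * F (x₀ + c • y) := by
    funext y
    rw [zoom_apply, norm_smul, Real.norm_of_nonneg hc.le, mul_pow]
  rw [h1, integral_const_mul]
  have h2 : ∫ y in ball y₀ r, F (x₀ + c • y) =
      ∫ y, (ball (x₀ + c • y₀) (c * r)).indicator F (x₀ + c • y) := by
    rw [← integral_indicator measurableSet_ball, ← hpre]
    rfl
  rw [h2, integral_comp_space_affine hc x₀, integral_indicator measurableSet_ball,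
    finrank_euclideanSpace_fin, smul_eq_mul]
  field_simp

/-- **Scaling of the local dissipation**: `r⁻¹ ∫_{(s₀ - r², s₀)} ∫_{B(y₀, r)} |∇w(s)(y)|² dy ds =
(c r)⁻¹ ∫_{(c²s₀ - (cr)², c²s₀)} ∫_{B(x₀ + c y₀, c r)} |∇u(t)(x)|² dx dt` for the zoom
`w(s, y) = c u(c² s, x₀ + c y)` of a field with differentiable slices at negative times, when
`s₀ ≤ 0` (substitutions `x = x₀ + c y`, `t = c² s`; `∇w(s)(y) = c² ∇u(c²s)(x₀ + c y)`).
[folklore] -/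
theorem scaledGradEnergy_zoom {c : ℝ} (hc : 0 < c) (x₀ y₀ : EuclideanSpace ℝ (Fin 3))
    (u : ℝ → EuclideanSpace ℝ (Fin 3) → EuclideanSpace ℝ (Fin 3))
    (hd : ∀ t < 0, Differentiable ℝ (u t)) {s₀ : ℝ} (hs₀ : s₀ ≤ 0) {r : ℝ} (hr : 0 < r) :
    r⁻¹ * ∫ s in Ioo (s₀ - r ^ 2) s₀, ∫ y in ball y₀ r,
        ‖fderiv ℝ ((c • stPull (c ^ 2) c 0 x₀ u) s) y‖ ^ 2 =
      (c * r)⁻¹ * ∫ t in Ioo (c ^ 2 * s₀ - (c * r) ^ 2) (c ^ 2 * s₀),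
        ∫ x in ball (x₀ + c • y₀) (c * r), ‖fderiv ℝ (u t) x‖ ^ 2 := by
  have hc2 : 0 < c ^ 2 := by positivity
  set G : ℝ → ℝ := fun t => ∫ x in ball (x₀ + c • y₀) (c * r), ‖fderiv ℝ (u t) x‖ ^ 2 with hG
  have hpre := space_affine_preimage_ball_zoom hc x₀ y₀ r
  -- the inner integral at a time `s < 0`
  have hinner : ∀ s ∈ Ioo (s₀ - r ^ 2) s₀,
      ∫ y in ball y₀ r, ‖fderiv ℝ ((c • stPull (c ^ 2) c 0 x₀ u) s) y‖ ^ 2 =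
        c * G (0 + c ^ 2 * s) := by
    intro s hs
    have hsneg : c ^ 2 * s < 0 := mul_neg_of_pos_of_neg hc2 (hs.2.trans_le hs₀)
    set F : EuclideanSpace ℝ (Fin 3) → ℝ := fun x => ‖fderiv ℝ (u (c ^ 2 * s)) x‖ ^ 2 with hF
    have h1 : (fun y => ‖fderiv ℝ ((c • stPull (c ^ 2) c 0 x₀ u) s) y‖ ^ 2) =
        fun y => c ^ 4 * F (x₀ + c • y) := by
      funext y
      rw [fderiv_zoom x₀ u (hd _ hsneg) y, norm_smul, Real.norm_of_nonneg hc2.le, mul_pow]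
      ring
    rw [h1, integral_const_mul]
    have h2 : ∫ y in ball y₀ r, F (x₀ + c • y) =
        ∫ y, (ball (x₀ + c • y₀) (c * r)).indicator F (x₀ + c • y) := by
      rw [← integral_indicator measurableSet_ball, ← hpre]
      rfl
    rw [h2, integral_comp_space_affine hc x₀, integral_indicator measurableSet_ball,
      finrank_euclideanSpace_fin, smul_eq_mul, zero_add]
    field_simp
    ring
  rw [setIntegral_congr_fun measurableSet_Ioo hinner, integral_const_mul,
    setIntegral_Ioo_comp_time_affine hc2 0 (s₀ - r ^ 2) s₀ G, smul_eq_mul]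
  have e1 : 0 + c ^ 2 * (s₀ - r ^ 2) = c ^ 2 * s₀ - (c * r) ^ 2 := by ring
  have e2 : 0 + c ^ 2 * s₀ = c ^ 2 * s₀ := by ring
  rw [e1, e2]
  field_simp

/-! ### The Leray-gauge middle strain eigenvalue -/

/-- **Gauge invariance of the middle strain eigenvalue**: for the zoom
`w(s, y) = c u(c² s, x₀ + c y)` of a field with differentiable slice `u (c² s)`, `s < 0`,
`Λ_w(s, y) = Λ_u(c² s, x₀ + c y)` (`∇w(s)(y) = c²∇u(c²s)(x₀ + cy)` and `(-s)c² = -(c²s)`; proved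
through the two-frame Courant–Fischer forms). [folklore] -/
theorem lerayMiddleStrain_zoom {c : ℝ} (hc : 0 < c) (x₀ : EuclideanSpace ℝ (Fin 3))
    (u : ℝ → EuclideanSpace ℝ (Fin 3) → EuclideanSpace ℝ (Fin 3)) {s : ℝ} (hs : s < 0)
    (hd : Differentiable ℝ (u (c ^ 2 * s))) (y : EuclideanSpace ℝ (Fin 3)) :
    lerayMiddleStrain (c • stPull (c ^ 2) c 0 x₀ u) s y =
      lerayMiddleStrain u (c ^ 2 * s) (x₀ + c • y) := by
  have hc2 : 0 < c ^ 2 := by positivity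
  have hs' : c ^ 2 * s < 0 := mul_neg_of_pos_of_neg hc2 hs
  have hD := fderiv_zoom x₀ u hd y
  -- the quadratic forms agree
  have hq : ∀ ξ : EuclideanSpace ℝ (Fin 3),
      (-s) * inner ℝ (fderiv ℝ ((c • stPull (c ^ 2) c 0 x₀ u) s) y ξ) ξ =
        (-(c ^ 2 * s)) * inner ℝ (fderiv ℝ (u (c ^ 2 * s)) (x₀ + c • y) ξ) ξ := by
    intro ξ
    rw [hD, _root_.smul_apply, real_inner_smul_left]
    ring
  refine le_antisymm ?_ ?_
  · rw [lerayMiddleStrain_le_iff hs]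
    obtain ⟨v, w, hv, hw, hvw, h⟩ :=
      (lerayMiddleStrain_le_iff hs' (lerayMiddleStrain u (c ^ 2 * s) (x₀ + c • y))).1 le_rfl
    exact ⟨v, w, hv, hw, hvw, fun α β => by rw [hq]; exact h α β⟩
  · rw [le_lerayMiddleStrain_iff hs]
    obtain ⟨v, w, hv, hw, hvw, h⟩ :=
      (le_lerayMiddleStrain_iff hs' (lerayMiddleStrain u (c ^ 2 * s) (x₀ + c • y))).1 le_rfl
    exact ⟨v, w, hv, hw, hvw, fun α β => by rw [hq]; exact h α β⟩

end Zoom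

end Summit.NavierStokesRegularity.NavierStokesRegularity.Theorems

end
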